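import Literature.NumberTheory.Automorphic.HyperspecialUnitaryRankOneHeckeNeighbours   -- ★ `UnramifiedLocalConjDatum.torusGen`, `torusGen_pow_eq` (brings ★ `heckeCosetMk_zpowDiagGL_eq_of_unitary`, ★ `heckeAlgebra.coe_mem_orbit_coe_iff`)
import HarnessLib

/-!
# R90 · S6 «Ch. 14.1–14.5 stable TF» — WAVE 8 card W8-a: CARTAN EXHAUSTION OF `U(σ, J₀)(K)` AT `N = 3`, ORBIT CURRENCY
# `∀ g, ∃ m ∈ ℕ, gK₀ ∈ K₀ tᵐ K₀ ∕ K₀` (`t = diag(ϖ, 1, ϖ⁻¹)`, `K₀ = unitaryInt`) (`Theorems/R90S6CartanExhaustionU3.lean`)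

Cell `hodgecm-mathlib`, crux H413 (`stmt-HodgeConjecture-24833`), route `HCCMUnconditional`; programme R90-TF, section S6 (base `R90-C14`, dealer R90-C14-plan (g2)),
seat R90-C14-p10 (g0); card **W8-a** of the S6 WAVE 8 sheet `R90/R90-C14-typ2/g2/S6_wave8_targets.v1.b05122f413d1b42e.lean` :51–:56 (R90-C14-typ2 (g2), DEAL #3
«HEADS-E1353.v1»; DAG r5 row E1.3.5.1.3 «spheres = Cartan double cosets»), statement VERBATIM (namespace `…R90.S6`, the sheet's `.Wave8` dropped per house rule (1)).
Lane `--kind proof --supports stmt-HodgeConjecture-24833` (helper; ONE public theorem; no definition, no instance, no notation, no named fact, no `sorry`).  Imports: ★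
`Literature…HyperspecialUnitaryRankOneHeckeNeighbours` + HarnessLib; no `Cruxes` import.

THE MATHEMATICS (Bruhat–Tits 1972 (4.4.3); Tits 1979 §3.3.3).  `G = U(σ, J₀)(K)`, `J₀ = antidiag(1,1,1)`, `K₀ = unitaryInt` (hyperspecial), `t = hd.torusGen = diag(ϖ, 1, ϖ⁻¹)`.
★ `heckeCosetMk_zpowDiagGL_eq_of_unitary` (the Cartan decomposition of the quasi-split unitary group, every residue characteristic, no finiteness) puts every `g` in a double
coset `K₀ diag(ϖ^a) K₀` with `a ∈ ℤ³` antitone and `a ∘ rev = −a`; on `Fin 3` these two conditions read `a₁ = −a₁`, `a₂ = −a₀`, `a₀ ≥ a₁`, i.e. `a = m·(1, 0, −1)` with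
`m = a₀ ∈ ℕ`, and `diag(ϖ^{m(1,0,−1)}) = tᵐ` (★ `torusGen_pow_eq`); finally «`g ∈ K₀ tᵐ K₀`» is «`gK₀ ∈ K₀·(tᵐK₀)`» in the orbit currency of the W7∕W8 sheets
(★ `heckeAlgebra.coe_mem_orbit_coe_iff`, the same `∃ k₁ ∈ K₀, ∃ k₂ ∈ K₀, g = k₁ tᵐ k₂` as ★ `heckeAlgebra.heckeCosetMk_eq_iff`).  The shell index `m` is unique (★
`disjoint_doubleCoset_torusGen_pow`, not restated).  WHY ON PATH: W8-b∕c∕d (index of the shell = sphere count; the index separates double cosets = the `hsep` payer of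
W7-c∕W7-d; the sphere dictionary) all start from «every coset lies on some shell `m`» — this file, by name.
HONEST LABEL: a three-line reading of the ★ unitary Cartan decomposition at `N = 3`; proves no printed global statement, discharges no citation; count-neutral helper until
the E1.3.9 assembly consumes it.  HC_CM is proved only modulo the 7 printed citations (2 remaining named inputs: hLiu418 = stmt-HodgeConjecture-24832, h413 =
stmt-HodgeConjecture-24833) until rung 0 closes.

## References
* [BruhatTits1972] F. Bruhat, J. Tits, *Groupes réductifs sur un corps local I*, Publ. Math. IHÉS 41 (1972), (4.4.3) (`G = K·V_D·K`, `V_D → K\G∕K` bijective).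
* [Tits1979] J. Tits, *Reductive groups over local fields*, PSPM 33.1 (1979), §3.3.3 (Cartan decomposition at a hyperspecial vertex).
-/
set_option autoImplicit false
-- the mandated namespace repeats the single-problem summit's segment (`HodgeConjecture.HodgeConjecture`)
set_option linter.dupNamespace false

noncomputable section

open scoped Valued WithZero Matrix MatrixGroups
open Literature.NumberTheory.Automorphic Literature.NumberTheory.Automorphic.HermitianLattice

namespace Summit.HodgeConjecture.HodgeConjecture.R90.S6

variable {K : Type*} [Field K] [Valued K ℤᵐ⁰] {σ : K →+* K} {ϖ : K}

/-- **W8-a — CARTAN EXHAUSTION AT `N = 3`, ORBIT CURRENCY.**  For the quasi-split unitary group `U(σ, J₀)(K)` (`J₀ = antidiag(1,1,1)`) over an unramified local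
conjugation datum and its hyperspecial subgroup `K₀ = unitaryInt`: every left coset `g K₀` lies in `K₀ tᵐ K₀ ∕ K₀` for some `m ∈ ℕ`, `t = hd.torusGen = diag(ϖ, 1, ϖ⁻¹)`
(unique by ★ `disjoint_doubleCoset_torusGen_pow`).  Proof: ★ `heckeCosetMk_zpowDiagGL_eq_of_unitary` gives `g ∈ K₀ diag(ϖ^a) K₀` with `a` antitone, `a ∘ rev = −a`; on
`Fin 3` this forces `a = m·(1,0,−1)`, `m = a₀ ≥ 0`; ★ `torusGen_pow_eq`; ★ `heckeAlgebra.coe_mem_orbit_coe_iff`. [cite: BruhatTits1972, (4.4.3)] [cite: Tits1979, §3.3.3] -/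
theorem exists_mem_orbit_torusGen_pow_three (hd : UnramifiedLocalConjDatum σ ϖ)
    (g : unitaryGroupOfForm σ ((StdForm.antidiagonal 3).over K)) :
    ∃ m : ℕ, (g : unitaryGroupOfForm σ ((StdForm.antidiagonal 3).over K) ⧸ unitaryInt σ ((StdForm.antidiagonal 3).over K)) ∈
      MulAction.orbit (unitaryInt σ ((StdForm.antidiagonal 3).over K))
        ((hd.torusGen ^ m : unitaryGroupOfForm σ ((StdForm.antidiagonal 3).over K)) :
          unitaryGroupOfForm σ ((StdForm.antidiagonal 3).over K) ⧸ unitaryInt σ ((StdForm.antidiagonal 3).over K)) := by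
  obtain ⟨a, ha, h⟩ := heckeCosetMk_zpowDiagGL_eq_of_unitary hd g
  -- on `Fin 3`, antitone + `a ∘ rev = -a` force `a = m·(1,0,-1)` with `m = a 0 ∈ ℕ`
  have h1 : a 1 = 0 := by
    have e := ha.2 1
    rw [show Fin.rev (1 : Fin 3) = 1 from rfl] at e
    omega
  have h2 : a 2 = -a 0 := by
    have e := ha.2 0
    rw [show Fin.rev (0 : Fin 3) = 2 from rfl] at e
    exact e
  have h0 : 0 ≤ a 0 := by
    rw [← h1]
    exact ha.1 (show (0 : Fin 3) ≤ 1 by decide)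
  obtain ⟨m, hm⟩ := Int.eq_ofNat_of_zero_le h0
  have ham : a = (m : ℤ) • (![1, 0, -1] : Fin 3 → ℤ) := by
    funext i
    fin_cases i
    · simp [hm]
    · simp [h1]
    · simp [h2, hm]
  subst ham
  refine ⟨m, ?_⟩
  rw [hd.torusGen_pow_eq m, heckeAlgebra.coe_mem_orbit_coe_iff]
  exact (heckeAlgebra.heckeCosetMk_eq_iff _ _ _).1 h

end Summit.HodgeConjecture.HodgeConjecture.R90.S6

end
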